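import Mathlib
import Literature.AlgebraicGeometry.Resolution.LogRegularScheme
import Summits.ResolutionOfSingularities.ResolutionOfSingularities.Theorems.RadicialJungCleanModelsSufficeKummerOrderStructure
import Summits.ResolutionOfSingularities.ResolutionOfSingularities.Theorems.RadicialJungCleanModelsSufficeKummerOrderLogRegular

/-!
# Route `RadicialJung`, crux `CleanModelsSuffice`: Kato's ideal of the Kummer chart

Let `A` be a regular local ring with fraction field `K` of characteristic `p`, `L/K` of degree
`p`, `y ∈ L ∖ K` with `y^p = ∏_{i ≤ m} t_i^{a_i}` (`t_i ∈ A ∖ 0`, `a₀ = 1`, `1 ≤ a_i < p`), and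
`R = ⊕_{j<p} A · z_j ⊆ L` the Kummer order (`z_j = y^j / ∏_i t_i^{⌊j a_i/p⌋}`, a free `A`-module
by `stub_kummerOrderStructure`). Let `S ≠ ∅` index the `t_i` lying in the maximal ideal of `A`,
`P = {c ∈ ℤ^{m+1} | 0 ≤ c₀, 0 ≤ a_i c₀ + p c_i (i ≠ 0)}` and `φ : P → R` the chart
`c ↦ y^{c₀} ∏_{i≠0} t_i^{c_i}`. This file proves `stub_kummerOrderNonunitIdeal`:

1. Kato's ideal (generated by the non-unit chart elements) is `I = (z₁, …, z_{p-1}) + (t_S)·R`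
   (as in `stub_kummerOrderLogRegular`, by the factorisation `φ(c) = z_{c₀ mod p} · ∏ t_i^{e_i}`
   of `RadicialJungCleanModelsSufficeKummerOrderChart.lean`).
2. For EVERY `E ⊆ A`, `A → R/(I + E·R)` is surjective with kernel `(t_S) + (E)` (no reducedness
   of `A/((t_S) + (E))` being available, this uses the freeness of `R`): the `z₀`-coordinate
   `ψ : R → A` of the basis `z₀ = 1, …, z_{p-1}` (`kummerOrder_coord`) maps the `A`-module
   `N = ⊕_{j≥1} A z_j + ((t_S) + (E))·R ⊇ I + E·R` into `(t_S) + (E)`, and `N` is an ideal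
   (`z_k z_j = (∏ t_i^{e_i}) z_{(k+j) mod p}`, `z_j z_{p-j} ∈ (∏_i t_i) ⊆ (t_S)`).
-/

noncomputable section

set_option linter.dupNamespace false -- mandated namespace of this single-conjunct summit

open Literature.AlgebraicGeometry.Resolution

namespace Summit.ResolutionOfSingularities.ResolutionOfSingularities.Theorems.RadicialJung.CleanModelsSuffice

/-- For `j + k = p` and `p ∤ j a`: `⌊j a/p⌋ + ⌊k a/p⌋ < a` (so `z_j z_{p-j} ∈ (∏_i t_i)`).
[folklore] -/
theorem kummer_floor_add_floor_lt (p a j k : ℕ) (hjk : j + k = p) (hndvd : ¬ p ∣ j * a) :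
    j * a / p + k * a / p < a := by
  have h1 : j * a / p * p < j * a := lt_of_le_of_ne (Nat.div_mul_le_self _ _)
    fun h => hndvd ⟨j * a / p, by rw [mul_comm p]; exact h.symm⟩
  have h3 : (j * a / p + k * a / p) * p < a * p := by
    calc (j * a / p + k * a / p) * p = j * a / p * p + k * a / p * p := add_mul _ _ _
      _ < j * a + k * a := add_lt_add_of_lt_of_le h1 (Nat.div_mul_le_self _ _)
      _ = a * p := by rw [← add_mul, hjk, mul_comm]
  exact Nat.lt_of_mul_lt_mul_right h3

section KummerChart

variable {A K L : Type} [CommRing A] [IsRegularLocalRing A] [Field K] [Algebra A K]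
  [IsFractionRing A K] [Field L] [Algebra K L] [Algebra A L] [IsScalarTower A K L]
  {p : ℕ} {z : Fin p → L}

/-- **The `z₀`-coordinate of the Kummer order.** In the situation of `stub_kummerOrderStructure`
(`R = ⊕_{j<p} A z_j` freely, `z₀ = 1`) there is an `A`-linear form `ψ : R → A` with `ψ(1) = 1`,
`ψ(z_j) = 0` for `j ≠ 0`, and `r - ψ(r)·1 ∈ ⊕_{j ≥ 1} A z_j` for every `r ∈ R`. [folklore] -/
theorem kummerOrder_coord (hp : p.Prime) [CharP K p] (hdeg : Module.finrank K L = p) (m : ℕ)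
    (t : Fin (m + 1) → A) (ht : ∀ i, t i ≠ 0) (a : Fin (m + 1) → ℕ) (ha0 : a 0 = 1)
    (ha : ∀ i, 1 ≤ a i ∧ a i < p) (y : L) (hy : y ∉ Set.range (algebraMap K L))
    (hyp : y ^ p = algebraMap A L (∏ i, t i ^ a i))
    (hz : ∀ j, z j = y ^ (j : ℕ) / algebraMap A L (∏ i, t i ^ ((j : ℕ) * a i / p))) :
    ∃ ψ : Algebra.adjoin A (Set.range z) →ₗ[A] A, ψ 1 = 1 ∧
      (∀ j : Fin p, (j : ℕ) ≠ 0 → ψ ⟨z j, Algebra.subset_adjoin (Set.mem_range_self j)⟩ = 0) ∧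
      ∀ r : Algebra.adjoin A (Set.range z), r - algebraMap A _ (ψ r) ∈ Submodule.span A
        ((fun j : Fin p => (⟨z j, Algebra.subset_adjoin (Set.mem_range_self j)⟩ :
          Algebra.adjoin A (Set.range z))) '' {j | (j : ℕ) ≠ 0}) := by
  obtain ⟨hspanL, hliL, -, -, -⟩ :=
    stub_kummerOrderStructure p hp hdeg m t ht a ha0 ha y hy hyp z hz
  let R : Subalgebra A L := Algebra.adjoin A (Set.range z)
  set zR : Fin p → R := fun j => ⟨z j, Algebra.subset_adjoin (Set.mem_range_self j)⟩ with hzRdef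
  set j0 : Fin p := ⟨0, hp.pos⟩ with hj0def
  have hz0 : zR j0 = 1 := Subtype.ext (kummer_z_zero hp hz)
  have hcomp : ((Subalgebra.val R).toLinearMap : R →ₗ[A] L) ∘ zR = z := funext fun j => rfl
  have hliR : LinearIndependent A zR :=
    LinearIndependent.of_comp ((Subalgebra.val R).toLinearMap : R →ₗ[A] L)
      (by rw [hcomp]; exact hliL)
  have hspR : ⊤ ≤ Submodule.span A (Set.range zR) := by
    rintro r -
    have hr : (r : L) ∈ Submodule.map ((Subalgebra.val R).toLinearMap : R →ₗ[A] L)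
        (Submodule.span A (Set.range zR)) := by
      rw [Submodule.map_span, ← Set.range_comp, hcomp, ← hspanL]
      exact r.2
    obtain ⟨r', hr', hr'eq⟩ := hr
    rwa [← (Subtype.val_injective hr'eq : r' = r)]
  let b : Module.Basis (Fin p) A R := Module.Basis.mk hliR hspR
  have hb : ∀ j, b j = zR j := fun j => Module.Basis.mk_apply hliR hspR j
  have hψz : ∀ j, b.coord j0 (zR j) = if j = j0 then 1 else 0 := fun j =>
    Module.Basis.mk_coord_apply
  have hψ1 : b.coord j0 1 = 1 := by rw [← hz0, hψz, if_pos rfl]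
  refine ⟨b.coord j0, hψ1, fun j hj => ?_, fun r => ?_⟩
  · have hne : j ≠ j0 := fun h => hj (by rw [h])
    rw [hψz, if_neg hne]
  · have hsum := b.sum_repr r
    rw [← Finset.add_sum_erase _ _ (Finset.mem_univ j0)] at hsum
    have h0 : b.repr r j0 • b j0 = algebraMap A R (b.coord j0 r) := by
      rw [hb, hz0, Algebra.algebraMap_eq_smul_one]
      rfl
    rw [h0] at hsum
    rw [sub_eq_of_eq_add' hsum.symm]
    refine Submodule.sum_mem _ fun i hi => Submodule.smul_mem _ _
      (Submodule.subset_span ⟨i, ?_, (hb i).symm⟩)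
    have hne : i ≠ j0 := Finset.ne_of_mem_erase hi
    exact fun h => hne (Fin.ext h)

/-- **Kato's ideal of the Kummer chart** (general family `z` with
`z_j = y^j / ∏ t_i^{⌊j a_i/p⌋}`). In the situation of `stub_kummerOrderStructure`, with `S ≠ ∅`
the indices of the `t_i` in the maximal ideal, `P = {c | 0 ≤ c₀, 0 ≤ a_i c₀ + p c_i (i ≠ 0)}` and
`φ(c) = y^{c₀} ∏_{i≠0} t_i^{c_i}`: Kato's ideal of `(R, φ)` is `(z₁, …, z_{p-1}) + (t_i : i ∈ S)·R`,
and for every `E ⊆ A` the composite `A → R → R/(I + E·R)` is surjective with kernel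
`(t_i : i ∈ S) + (E)`. [folklore] -/
theorem kummerOrder_nonunitIdeal (hp : p.Prime) [CharP K p] (hdeg : Module.finrank K L = p)
    (m : ℕ) (t : Fin (m + 1) → A) (ht : ∀ i, t i ≠ 0) (a : Fin (m + 1) → ℕ) (ha0 : a 0 = 1)
    (ha : ∀ i, 1 ≤ a i ∧ a i < p) (y : L) (hy : y ∉ Set.range (algebraMap K L))
    (hyp : y ^ p = algebraMap A L (∏ i, t i ^ a i))
    (S : Finset (Fin (m + 1))) (hS : ∀ i, i ∈ S ↔ t i ∈ IsLocalRing.maximalIdeal A)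
    (hSne : S.Nonempty)
    (P : AddSubmonoid (Fin (m + 1) → ℤ))
    (hP : ∀ c : Fin (m + 1) → ℤ, c ∈ P ↔
      0 ≤ c 0 ∧ ∀ i : Fin (m + 1), i ≠ 0 → 0 ≤ (a i : ℤ) * c 0 + (p : ℤ) * c i)
    (hz : ∀ j, z j = y ^ (j : ℕ) / algebraMap A L (∏ i, t i ^ ((j : ℕ) * a i / p)))
    (φ : Multiplicative P →* Algebra.adjoin A (Set.range z))
    (hφ : ∀ c : P, ((φ (Multiplicative.ofAdd c) : Algebra.adjoin A (Set.range z)) : L) =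
      y ^ ((c : Fin (m + 1) → ℤ) 0) *
        ∏ i ∈ Finset.univ.erase 0, algebraMap A L (t i) ^ ((c : Fin (m + 1) → ℤ) i)) :
    LogChart.nonunitIdeal P φ =
      Ideal.span ((fun j : Fin p => (⟨z j, Algebra.subset_adjoin (Set.mem_range_self j)⟩ :
          Algebra.adjoin A (Set.range z))) '' {j | (j : ℕ) ≠ 0}) ⊔
        (Ideal.span (t '' (S : Set (Fin (m + 1))))).map (algebraMap A _) ∧
    ∀ E : Set A,
      Function.Surjective ((Ideal.Quotient.mk (LogChart.nonunitIdeal P φ ⊔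
          (Ideal.span E).map (algebraMap A _))).comp (algebraMap A _)) ∧
      RingHom.ker ((Ideal.Quotient.mk (LogChart.nonunitIdeal P φ ⊔
          (Ideal.span E).map (algebraMap A _))).comp (algebraMap A _)) =
        Ideal.span (t '' (S : Set (Fin (m + 1)))) ⊔ Ideal.span E := by
  haveI : Fact p.Prime := ⟨hp⟩
  haveI : CharP L p := charP_of_injective_algebraMap (algebraMap K L).injective p
  haveI := isDomain_of_isRegularLocalRing A
  have hinj : Function.Injective (algebraMap A L) :=
    algebraMap_injective_of_isFractionRing_tower K
  have ht0 : ∀ i, algebraMap A L (t i) ≠ 0 := fun i => (map_ne_zero_iff _ hinj).mpr (ht i)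
  have hne : ∀ e : Fin (m + 1) → ℕ, algebraMap A L (∏ i, t i ^ e i) ≠ 0 := fun e =>
    (map_ne_zero_iff _ hinj).mpr (Finset.prod_ne_zero_iff.mpr fun i _ => pow_ne_zero _ (ht i))
  have hzp : ∀ j, ∃ b : A, z j ^ p = algebraMap A L b := fun j => ⟨_, kummer_z_pow hyp hz hne j⟩
  have hunit : ∀ i, ¬ IsUnit (t i) ↔ i ∈ S := fun i => by
    rw [hS i, IsLocalRing.mem_maximalIdeal, mem_nonunits_iff]
  obtain ⟨ψ, hψ1, hψz, hdecomp⟩ := kummerOrder_coord hp hdeg m t ht a ha0 ha y hy hyp hz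
  let R : Subalgebra A L := Algebra.adjoin A (Set.range z)
  set zR : Fin p → R := fun j => ⟨z j, Algebra.subset_adjoin (Set.mem_range_self j)⟩ with hzRdef
  have hzRj : ∀ j, (⟨z j, Algebra.subset_adjoin (Set.mem_range_self j)⟩ : R) = zR j :=
    fun j => rfl
  set T : Ideal A := Ideal.span (t '' (S : Set (Fin (m + 1)))) with hTdef
  set j0 : Fin p := ⟨0, hp.pos⟩ with hj0def
  obtain ⟨i₀, hi₀⟩ := hSne
  have hti₀ : ¬ IsUnit (t i₀) := (hunit i₀).mpr hi₀
  have hz0 : zR j0 = 1 := Subtype.ext (kummer_z_zero hp hz)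
  have hψalg : ∀ x : A, ψ (algebraMap A _ x) = x := fun x => by
    rw [Algebra.algebraMap_eq_smul_one, map_smul, hψ1, smul_eq_mul, mul_one]
  have hAunit : ∀ i ∈ S, ¬ IsUnit (algebraMap A R (t i)) :=
    fun i hi hu => (hunit i).mpr hi (kummer_isUnit_of_isUnit_algebraMap hinj hzp hu)
  have hzunit : ∀ j : Fin p, (j : ℕ) ≠ 0 → ¬ IsUnit (zR j) := fun j hj =>
    kummer_not_isUnit_z hinj hyp hz hne hti₀ (ha i₀) hj
  -- the special elements `B i ↦ t_i` and `C j ↦ z_j` of `P`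
  obtain ⟨B, hB⟩ : ∃ B : Fin (m + 1) → Fin (m + 1) → ℤ, ∀ i k, B i k =
      if i = 0 then (if k = 0 then (p : ℤ) else -(a k : ℤ)) else if i = k then 1 else 0 :=
    ⟨fun i k => _, fun i k => rfl⟩
  obtain ⟨C, hC⟩ : ∃ C : Fin p → Fin (m + 1) → ℤ, ∀ j k, C j k =
      if k = 0 then ((j : ℕ) : ℤ) else -(((j : ℕ) * a k / p : ℕ) : ℤ) :=
    ⟨fun j k => _, fun j k => rfl⟩
  have hBP : ∀ i, B i ∈ P := fun i => (hP _).mpr (kummerB_mem hB i)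
  have hCP : ∀ j, C j ∈ P := fun j => (hP _).mpr (kummerC_mem hC j)
  have hφB : ∀ i, φ (Multiplicative.ofAdd ⟨B i, hBP i⟩) = algebraMap A R (t i) := by
    intro i
    rw [kummer_factor_mk (c := B i) hp hyp hz hne ht0 (kummerB_mem hB i).1
      (kummerB_exp hB hp ha0 i) _ (hφ ⟨B i, hBP i⟩)]
    have hfin : (⟨(B i 0).toNat % p, Nat.mod_lt _ hp.pos⟩ : Fin p) = j0 :=
      Fin.ext (kummerB_zero_mod hB i)
    rw [hzRj, hfin, hz0, one_mul]
    congr 1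
    rw [Finset.prod_eq_single i (fun k _ hk => by rw [if_neg hk, pow_zero]) (by simp)]
    simp
  have hφC : ∀ j, φ (Multiplicative.ofAdd ⟨C j, hCP j⟩) = zR j := by
    intro j
    rw [kummer_factor_mk (c := C j) hp hyp hz hne ht0 (kummerC_mem hC j).1
      (kummerC_exp hC ha0 j) _ (hφ ⟨C j, hCP j⟩)]
    have hfin : (⟨(C j 0).toNat % p, Nat.mod_lt _ hp.pos⟩ : Fin p) = j :=
      Fin.ext (kummerC_zero_mod hC j)
    simp only [pow_zero, Finset.prod_const_one, map_one, mul_one]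
    exact Subtype.ext (by rw [hfin])
  -- Kato's ideal is `(z_{≥1}) + (t_S) R`
  have hJz : ∀ j : Fin p, (j : ℕ) ≠ 0 → (⟨z j, Algebra.subset_adjoin ⟨j, rfl⟩⟩ : R) ∈
      Ideal.span (zR '' {j | (j : ℕ) ≠ 0}) ⊔ T.map (algebraMap A R) :=
    fun j hj => Ideal.mem_sup_left (Ideal.subset_span ⟨j, hj, rfl⟩)
  have hJt : ∀ i, ¬ IsUnit (t i) →
      algebraMap A R (t i) ∈ Ideal.span (zR '' {j | (j : ℕ) ≠ 0}) ⊔ T.map (algebraMap A R) :=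
    fun i hi => Ideal.mem_sup_right (Ideal.mem_map_of_mem _ (Ideal.subset_span
      (Set.mem_image_of_mem t (Finset.mem_coe.mpr ((hunit i).mp hi)))))
  have hI : LogChart.nonunitIdeal P φ =
      Ideal.span (zR '' {j | (j : ℕ) ≠ 0}) ⊔ T.map (algebraMap A R) := by
    apply le_antisymm
    · refine Ideal.span_le.2 ?_
      rintro _ ⟨c, hc, rfl⟩
      obtain ⟨hc0, hci⟩ := (hP _).mp c.2
      exact kummer_mem_of_not_isUnit hp hyp hz hne ht0 hJz hJt hc0 hci _ (hφ c) hc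
    · refine sup_le (Ideal.span_le.2 ?_) (Ideal.map_le_iff_le_comap.2 (Ideal.span_le.2 ?_))
      · rintro _ ⟨j, hj, rfl⟩
        refine Ideal.subset_span ⟨⟨C j, hCP j⟩, ?_, hφC j⟩
        show ¬ IsUnit (φ (Multiplicative.ofAdd ⟨C j, hCP j⟩))
        rw [hφC j]
        exact hzunit j hj
      · rintro _ ⟨i, hi, rfl⟩
        rw [SetLike.mem_coe, Ideal.mem_comap]
        refine Ideal.subset_span ⟨⟨B i, hBP i⟩, ?_, hφB i⟩
        show ¬ IsUnit (φ (Multiplicative.ofAdd ⟨B i, hBP i⟩))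
        rw [hφB i]
        exact hAunit i (Finset.mem_coe.mp hi)
  refine ⟨hI, fun E => ?_⟩
  have hmulR : ∀ j k : Fin p, zR j * zR k =
      algebraMap A R (∏ i, t i ^ (((j : ℕ) + k) * a i / p - (j : ℕ) * a i / p -
        (k : ℕ) * a i / p)) * zR ⟨((j : ℕ) + k) % p, Nat.mod_lt _ hp.pos⟩ := fun j k =>
    Subtype.ext (by
      show z j * z k = algebraMap A L _ * z ⟨_, _⟩
      rw [hz, hz, hz]
      exact kummer_generator_mul K p hp.pos t ht a y hyp j k)
  have hndvd : ∀ j : Fin p, (j : ℕ) ≠ 0 → ¬ p ∣ (j : ℕ) * a i₀ := fun j hj hdvd => by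
    rcases (Nat.Prime.dvd_mul hp).mp hdvd with h1 | h1
    · exact hj (Nat.eq_zero_of_dvd_of_lt h1 j.2)
    · exact absurd (Nat.eq_zero_of_dvd_of_lt h1 (ha i₀).2) (by have := (ha i₀).1; omega)
  -- the ideal `N = ⊕_{j ≥ 1} A z_j + ((t_S) + (E)) R`
  set TE : Ideal A := T ⊔ Ideal.span E with hTEdef
  set N : Submodule A R := Submodule.span A (zR '' {j | (j : ℕ) ≠ 0}) ⊔ TE • ⊤ with hNdef
  have hZmul : ∀ k j : Fin p, (j : ℕ) ≠ 0 → zR k * zR j ∈ N := by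
    intro k j hj
    rw [hmulR k j]
    by_cases hl : ((k : ℕ) + j) % p = 0
    · have hidx : (⟨((k : ℕ) + j) % p, Nat.mod_lt _ hp.pos⟩ : Fin p) = j0 := Fin.ext hl
      rw [hidx, hz0, mul_one]
      refine Submodule.mem_sup_right ?_
      rw [Algebra.algebraMap_eq_smul_one]
      refine Submodule.smul_mem_smul (Ideal.mem_sup_left ?_) Submodule.mem_top
      have hkj : (k : ℕ) + j = p := by
        have h1 : (k : ℕ) + j < 2 * p := by have := k.2; have := j.2; omega
        exact Nat.eq_of_dvd_of_lt_two_mul (by omega) (Nat.dvd_of_mod_eq_zero hl) h1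
      have hlt := kummer_floor_add_floor_lt p (a i₀) j k (by omega) (hndvd j hj)
      have hexp : 0 < ((k : ℕ) + j) * a i₀ / p - (k : ℕ) * a i₀ / p - (j : ℕ) * a i₀ / p := by
        rw [hkj, Nat.mul_div_cancel_left _ hp.pos]
        omega
      have hi₀S : i₀ ∈ (S : Set (Fin (m + 1))) := Finset.mem_coe.mpr hi₀
      exact Ideal.mem_of_dvd _ (Finset.dvd_prod_of_mem _ (Finset.mem_univ i₀))
        (Ideal.pow_mem_of_mem T (Ideal.subset_span (Set.mem_image_of_mem t hi₀S)) _ hexp)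
    · refine Submodule.mem_sup_left ?_
      rw [← Algebra.smul_def]
      exact Submodule.smul_mem _ _ (Submodule.subset_span ⟨_, hl, rfl⟩)
  have hNmap : ∀ k : Fin p, Submodule.map (LinearMap.mulLeft A (zR k)) N ≤ N := by
    intro k
    rw [hNdef, Submodule.map_sup]
    refine sup_le ?_ ?_
    · rw [Submodule.map_span, Submodule.span_le]
      rintro _ ⟨_, ⟨j, hj, rfl⟩, rfl⟩
      exact hZmul k j hj
    · rw [Submodule.map_smul'']
      exact le_sup_of_le_right (Submodule.smul_mono le_rfl le_top)
  have hNmul : ∀ r n : R, n ∈ N → r * n ∈ N := by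
    intro r n hn
    have hr : r ∈ Submodule.span A (Set.range zR) := by
      rw [← sub_add_cancel r (algebraMap A R (ψ r))]
      refine Submodule.add_mem _ (Submodule.span_mono ?_ (hdecomp r)) ?_
      · rintro _ ⟨j, -, rfl⟩
        exact ⟨j, rfl⟩
      · rw [Algebra.algebraMap_eq_smul_one, ← hz0]
        exact Submodule.smul_mem _ _ (Submodule.subset_span ⟨j0, rfl⟩)
    refine Submodule.span_induction (p := fun r _ => r * n ∈ N) ?_ ?_ ?_ ?_ hr
    · rintro _ ⟨k, rfl⟩
      exact hNmap k (Submodule.mem_map_of_mem hn)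
    · rw [zero_mul]
      exact N.zero_mem
    · intro u v _ _ hu hv
      rw [add_mul]
      exact N.add_mem hu hv
    · intro x u _ hu
      rw [smul_mul_assoc]
      exact N.smul_mem x hu
  let N' : Ideal R :=
    { carrier := N
      add_mem' := fun hu hv => N.add_mem hu hv
      zero_mem' := N.zero_mem
      smul_mem' := fun r u hu => hNmul r u hu }
  have hN'mem : ∀ x, x ∈ N' ↔ x ∈ N := fun x => Iff.rfl
  have hIE : LogChart.nonunitIdeal P φ ⊔ (Ideal.span E).map (algebraMap A R) ≤ N' := by
    rw [hI]
    refine sup_le (sup_le ?_ ?_) ?_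
    · exact Ideal.span_le.2 fun x hx =>
        (hN'mem x).2 (Submodule.mem_sup_left (Submodule.subset_span hx))
    · rw [Ideal.map_le_iff_le_comap]
      refine Ideal.span_le.2 ?_
      rintro _ ⟨i, hi, rfl⟩
      rw [SetLike.mem_coe, Ideal.mem_comap, hN'mem, Algebra.algebraMap_eq_smul_one]
      exact Submodule.mem_sup_right (Submodule.smul_mem_smul
        (Ideal.mem_sup_left (Ideal.subset_span (Set.mem_image_of_mem t hi))) Submodule.mem_top)
    · rw [Ideal.map_le_iff_le_comap]
      refine Ideal.span_le.2 fun e he => ?_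
      rw [SetLike.mem_coe, Ideal.mem_comap, hN'mem, Algebra.algebraMap_eq_smul_one]
      exact Submodule.mem_sup_right (Submodule.smul_mem_smul
        (Ideal.mem_sup_right (Ideal.subset_span he)) Submodule.mem_top)
  -- the `z₀`-coordinates of `N` lie in `(t_S) + (E)`
  have hψN : ∀ x ∈ N, ψ x ∈ TE := by
    intro x hx
    obtain ⟨u, hu, v, hv, rfl⟩ := Submodule.mem_sup.mp hx
    rw [map_add]
    refine TE.add_mem ?_ ?_
    · refine Submodule.span_induction (p := fun u _ => ψ u ∈ TE) ?_ ?_ ?_ ?_ hu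
      · rintro _ ⟨j, hj, rfl⟩
        rw [hψz j hj]
        exact TE.zero_mem
      · rw [map_zero]
        exact TE.zero_mem
      · intro u v _ _ hu hv
        rw [map_add]
        exact TE.add_mem hu hv
      · intro x u _ hu
        rw [map_smul, smul_eq_mul]
        exact TE.mul_mem_left _ hu
    · refine Submodule.smul_induction_on hv ?_ ?_
      · intro r hr n _
        rw [map_smul, smul_eq_mul]
        exact TE.mul_mem_right _ hr
      · intro u v hu hv
        rw [map_add]
        exact TE.add_mem hu hv
  refine ⟨?_, ?_⟩
  · -- surjectivity of `A → R/(I + E R)`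
    intro q
    obtain ⟨r, rfl⟩ := Ideal.Quotient.mk_surjective q
    refine ⟨ψ r, ?_⟩
    rw [RingHom.comp_apply, Ideal.Quotient.eq, ← neg_sub]
    refine (Ideal.neg_mem_iff _).mpr ?_
    rw [hI]
    refine Ideal.mem_sup_left (Ideal.mem_sup_left ?_)
    have hsub : Submodule.span A (zR '' {j : Fin p | (j : ℕ) ≠ 0}) ≤
        (Ideal.span (zR '' {j : Fin p | (j : ℕ) ≠ 0})).restrictScalars A :=
      Submodule.span_le.2 Ideal.subset_span
    exact hsub (hdecomp r)
  · -- the kernel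
    ext x
    rw [RingHom.mem_ker, RingHom.comp_apply, Ideal.Quotient.eq_zero_iff_mem]
    constructor
    · exact fun hx => by simpa only [hψalg] using hψN _ ((hN'mem _).1 (hIE hx))
    · intro hx
      rw [hI, ← Ideal.mem_comap]
      refine (sup_le (fun x hx => ?_) (fun x hx => ?_) : TE ≤ Ideal.comap (algebraMap A R) _) hx
      · exact Ideal.mem_sup_left (Ideal.mem_sup_right (Ideal.mem_map_of_mem _ hx))
      · exact Ideal.mem_sup_right (Ideal.mem_map_of_mem _ hx)

end KummerChart

/-- STUB `stub_kummerOrderNonunitIdeal` of the line `Sketch` of crux `CleanModelsSuffice`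
(Kato's ideal of the Kummer chart, and the quotients by it together with further base elements).
In the situation of `stub_kummerOrderLogRegular`: Kato's ideal of `(R, φ)` is
`(z₁, …, z_{p-1}) + (t_i : i ∈ S)·R`, and for every set `E ⊆ A` the composite
`A → R → R/(I + E·R)` is surjective with kernel `(t_i : i ∈ S) + (E)` — so
`R/(I + E·R) ≅ A/((t_S) + (E))` (used with `E` = the uncharged boundary parameters through the
point). [folklore] -/
theorem stub_kummerOrderNonunitIdeal {A K L : Type} [CommRing A] [IsRegularLocalRing A] [Field K]
    [Algebra A K] [IsFractionRing A K] [Field L] [Algebra K L] [Algebra A L] [IsScalarTower A K L]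
    (p : ℕ) (hp : p.Prime) [CharP K p] (hdeg : Module.finrank K L = p) (m : ℕ)
    (t : Fin (m + 1) → A) (ht : ∀ i, t i ≠ 0) (a : Fin (m + 1) → ℕ) (ha0 : a 0 = 1)
    (ha : ∀ i, 1 ≤ a i ∧ a i < p) (y : L) (hy : y ∉ Set.range (algebraMap K L))
    (hyp : y ^ p = algebraMap A L (∏ i, t i ^ a i))
    (S : Finset (Fin (m + 1))) (hS : ∀ i, i ∈ S ↔ t i ∈ IsLocalRing.maximalIdeal A)
    (hSne : S.Nonempty)
    (P : AddSubmonoid (Fin (m + 1) → ℤ))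
    (hP : ∀ c : Fin (m + 1) → ℤ, c ∈ P ↔
      0 ≤ c 0 ∧ ∀ i : Fin (m + 1), i ≠ 0 → 0 ≤ (a i : ℤ) * c 0 + (p : ℤ) * c i)
    (φ : Multiplicative P →*
      Algebra.adjoin A (Set.range fun j : Fin p =>
        y ^ (j : ℕ) / algebraMap A L (∏ i, t i ^ ((j : ℕ) * a i / p))))
    (hφ : ∀ c : P, ((φ (Multiplicative.ofAdd c) : Algebra.adjoin A (Set.range fun j : Fin p =>
        y ^ (j : ℕ) / algebraMap A L (∏ i, t i ^ ((j : ℕ) * a i / p)))) : L) =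
      y ^ ((c : Fin (m + 1) → ℤ) 0) *
        ∏ i ∈ Finset.univ.erase 0, algebraMap A L (t i) ^ ((c : Fin (m + 1) → ℤ) i)) :
    LogChart.nonunitIdeal P φ =
      Ideal.span ((fun j : Fin p => (⟨y ^ (j : ℕ) / algebraMap A L (∏ i, t i ^ ((j : ℕ) * a i / p)),
          Algebra.subset_adjoin (Set.mem_range_self j)⟩ : Algebra.adjoin A (Set.range fun j : Fin p =>
            y ^ (j : ℕ) / algebraMap A L (∏ i, t i ^ ((j : ℕ) * a i / p))))) '' {j | (j : ℕ) ≠ 0}) ⊔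
        (Ideal.span (t '' (S : Set (Fin (m + 1))))).map (algebraMap A _) ∧
    ∀ E : Set A,
      Function.Surjective ((Ideal.Quotient.mk (LogChart.nonunitIdeal P φ ⊔
          (Ideal.span E).map (algebraMap A _))).comp (algebraMap A _)) ∧
      RingHom.ker ((Ideal.Quotient.mk (LogChart.nonunitIdeal P φ ⊔
          (Ideal.span E).map (algebraMap A _))).comp (algebraMap A _)) =
        Ideal.span (t '' (S : Set (Fin (m + 1)))) ⊔ Ideal.span E :=
  kummerOrder_nonunitIdeal hp hdeg m t ht a ha0 ha y hy hyp S hS hSne P hP (fun _ => rfl) φ hφ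

end Summit.ResolutionOfSingularities.ResolutionOfSingularities.Theorems.RadicialJung.CleanModelsSuffice

end
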